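import Summits.CriticalPhenomena.LaceExpansionHighD.MeanFieldD10F3CellsRev3
import Summits.CriticalPhenomena.LaceExpansionHighD.MeanFieldD10AppDRev3
import HarnessLib

/-!
# `d = 10`, line `Rev3` := (δ)+C-20(H0+H1)+C-21(psimono)+a5too (D77 typed-object pricing, E-9 lever; cut tag Rev3nbwC20C21A5too_cmuRev2) at the UNCHANGED Rev2 tuple (Γ, c, c_μ = cMuRev2) — RULING D55 (T-2 lead default of OPS-REQUESTS l.48, in force 2026-08-24T18:00Z): LEVEL B, kernel — the `f₃`-side of App. D at `inputsORev3` (`betaF3LE_corr_inputsORev3`), (S2b) on the window PROVED, (S2b) at `p_I`, and the LEVEL-B sentences `Rev3.meanField_d10_Rev3_f3` / `meanField_full_d10_Rev3_f3` / `nobleBootstrapBound_d10_Rev3_f3` / `triangleConditionFrom_d10_Rev3_f3` (draft section K; template `MeanFieldD10F3KernelRev2.lean`, typer g0 p331769)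

Split 5/5 (`MeanFieldD10F3KernelRev3.lean`) of the cell's ONE-FILE HOME draft `typed/rev3/MeanFieldD10Rev3Cut_DRAFT.lean` (sha256₁₆ fb6aa28a473f9326; farm rc 0 / 0 warnings / 0 sorry, `#print axioms` standard — lead g21/g22 acceptance) cut by `typed/rev3/split_rev3_cut.py` (typer g5) at the draft's own section markers: every Lean line of the section is the draft's VERBATIM; only this docstring, the import lines (`MeanFieldD10F3CellsRev3`, `MeanFieldD10AppDRev3`, `HarnessLib`) and the shared namespace wrapper are written by the splitter.  Import DAG of the five files: `CertRev3` → {`AppDRev3`, `HypothesesRev3`, `F3CellsRev3`} → `F3KernelRev3`.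
PROVENANCE (the draft's generator-written header, verbatim):
GENERATED by `typed/rev3/mk_rev3_cut.py` (typer g3; v2 typer g4: docstring prose refreshed by the generator — F3Cells §2 row values / margins from eng's
tree-route tables `F3_tree_q_Rev3nbwC20C21A5too_cmuRev2_table.md` (sha256₁₆ bf74d7e89a2dd2b0) / `F3_tree_cell7_Rev3nbwC20C21A5too_cmuRev2_table.md` (sha256₁₆ aab317d34eed7081), Hypotheses
rows R-I.1 / R-S.1 re-quoted with the Rev3 literals; no Lean token outside docstrings differs from v1's output 32c87681c85551d0) from (i) eng g11's PRE-POSITIONED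
re-emission `engine/ivq/t2g/delta/` tag `Rev3nbwC20C21A5too_cmuRev2`:
S2 certificate `cert_Rev3nbwC20C21A5too_cmuRev2_EXACT.json` (sha256₁₆ e8605162f32449a4) and the Lean text fragment `Rev3nbwC20C21A5too_cmuRev2_D10_inputs_lit20.lean.txt`
(sha256₁₆ 359a45fd6578884b); (ii) the TREE files of line `Rev2` as templates — `MeanFieldD10CertRev2.lean` (tables/certificate/sentences, lace7 p3 p321303) and
`MeanFieldD10AppDRev2.lean` (typer g0 p328465) — every non-literal line kept VERBATIM with the renames `Rev2 → Rev3` on declared names.  TUPLE BY NAME: `GammaRev2`,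
`cWeightsRev2`, `cMuRev2` (the generator ASSERTS the certificate's Γ, c, c_μ equal these literals — RULING D17 (2)/(3): Rev3 := (δ) at the UNCHANGED tuple); initial-point `f₃`
table BY NAME = `biRev2L` (`MeanFieldD10F3KernelRev2` §0: hypothesis-free SRW objects with the D10/D14 pads; the certificate's un-padded `bi` is asserted = `biRev2`).
NEW literals: `gammaRev3` = ('1.015480853', '1.165236335', '0.9801634381'), `BiRev3`, `BoRev3` (16 fields), `boRev3` (7), `inputsIRev3` / `inputsORev3` (2 × 60 fields, 20-digit outward).  Engine-side margins
(eng g11 `REV3-DELTA-C20C21.md` 40f5156c7e7f5d77): (Γ₁ − f₁)(o) = +2.195324e-5, (Γ₂ − f₂)(o) = +1.910754e-3, 1 − max bo/c = +2.2309932e-2; E1 245/245 rows.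
HONEST FRAMING: kernel arithmetic on literal tables + applications of d-generic tree theorems; every sentence is CONDITIONAL on (S2a) Assumption 4.3 at the two input records
(+ (S2b) the weighted-diagram bounds, as in line `Rev2`); NOT a proof that percolation on `ℤ¹⁰` is mean-field; no number here is printed by Fitzner–van der Hofstad.
-/

noncomputable section

namespace Summit.CriticalPhenomena.LaceExpansionHighD

namespace D10

open Literature.Barriers.CriticalPhenomena Literature.Probability.Percolation
open Literature.Probability.LatticeModels Literature.Probability.FitznerVanDerHofstad2017

namespace Rev3

open F3Bounds F3Bounds.CellNumQ KTUD10 KSupD10 TUSupD10 JSupD10 CellSupD10 CellImD10 SlotD10 SlotD10Phi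
open KTUD10 (dq)

/-! ## §1  The `f₃`-side of App. D at `inputsORev3` (kernel) and the literal table `EoL` -/

/-- Cap `μ ≤ 7/10` at `inputsORev3` (`μ ≈ 0.0533`). [cite: FitznerVanDerHofstad2016NoBLE, App. D (D.2)–(D.3) p. 1111 (Taylor caps)] -/
theorem capMu_inputsORev3 : inputsORev3.mu ≤ 7 / 10 := by norm_num [inputsORev3]

/-- Cap `Π_α-lower ≤ 1/8` at `inputsORev3`. [cite: FitznerVanDerHofstad2016NoBLE, App. D (D.2) p. 1111] -/
theorem capP_inputsORev3 : inputsORev3.piAlphaLower ≤ 1 / 8 := by norm_num [inputsORev3]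

/-- Cap `(2d−1)·μ̄ ≤ 2d·μ` at `inputsORev3` (`19·(2031/38000) ≤ 20·μ`). [cite: FitznerVanDerHofstad2016NoBLE, App. D (D.3) p. 1111] -/
theorem capQ_inputsORev3 : (2 * ((10 : ℕ) : ℝ) - 1) * inputsORev3.mub ≤ 2 * ((10 : ℕ) : ℝ) * inputsORev3.mu := by norm_num [inputsORev3]

set_option maxHeartbeats 4000000 in
/-- `EoL` DOMINATES the kernel-computed five further constants on the window: `BetaF3LE (ofFn extra^corr(inputsORev3)) EoL` (component by component:
(D.2) lower `c̲_Φ`, (D.3) upper `ᾱ_F`, (D.13) `β_{R,F}`, (D.21) printed `β_{ΔR,Φ}`, (D.29) `β_{|ΔR,F|}`; `norm_num`).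
[cite: FitznerVanDerHofstad2016NoBLE, Assumption 2.7 (a), (c); App. D (D.2), (D.3), (D.13), (D.21), (D.29) pp. 1110–1117] -/
theorem betaF3LE_corr_inputsORev3 :
    BetaF3LE (NobleBetaF3.ofFn (BetaMap.extraOfInputsCorr ((10 : ℕ) : ℝ) inputsORev3)) EoL := by
  constructor
  · simp only [NobleBetaF3.ofFn_cΦlow, BetaMap.extraOfInputsCorr_zero, BetaMap.extraOfInputs, Matrix.cons_val_zero]
    norm_num [BetaMap.betaCPhiLow, inputsORev3, EoL]
  · simp only [NobleBetaF3.ofFn_αFup, BetaMap.extraOfInputsCorr_one, BetaMap.extraOfInputs, Matrix.cons_val_zero, Matrix.cons_val_one]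
    norm_num [BetaMap.betaAfUp, inputsORev3, EoL]
  · simp only [NobleBetaF3.ofFn_βRF, BetaMap.extraOfInputsCorr_two, BetaMap.extraOfInputs, Matrix.cons_val_two, Matrix.head_cons, Matrix.tail_cons]
    norm_num [BetaMap.betaRF, inputsORev3, EoL]
  · simp only [NobleBetaF3.ofFn_βΔRΦ, BetaMap.extraOfInputsCorr_three]
    norm_num [BetaMap.betaRpDeltaCorr, inputsORev3, EoL]
  · simp only [NobleBetaF3.ofFn_βΔRFabs, BetaMap.extraOfInputsCorr_four, BetaMap.extraOfInputs, Matrix.cons_val_four, Matrix.head_cons, Matrix.tail_cons]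
    norm_num [BetaMap.betaRfDelta, inputsORev3, EoL]

/-- **The extended simplified `f₃`-form AT THE LITERAL TABLES `(BoRev3, EoL)` on the window** from Assumption 4.3 at `p` with `inputsORev3` (App. D
`f₃`-side in the kernel by `nobleSimplifiedFormF3At_percolation_of_weaker`, weakened along `betaLE_corr_inputsORev3` (Level A) and `betaF3LE_corr_inputsORev3`).
[cite: FitznerVanDerHofstad2016NoBLE, Prop. 4.5 p. 1088; Assumption 2.7; App. D (D.2), (D.3), (D.13), (D.21), (D.29)] [cite: FitznerVanDerHofstad2017, §2.5] -/
theorem nobleSimplifiedFormF3At_d10_Rev3_oL {p : unitInterval} (hp : p < criticalProbI 10) (hp0 : 0 < (p : ℝ))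
    (h43 : NobleAssumption43At 10 p (percolationNobleSplit 10 p (by norm_num) hp) inputsORev3) :
    NobleSimplifiedFormF3At 10 p BoRev3 EoL := by
  have h := nobleSimplifiedFormF3At_percolation_of_weaker (d := 10) (hd := by norm_num) (hp := hp) hp0 inputsORev3_WF h43 n1_inputsORev3
    n2_inputsORev3 n3_inputsORev3 n4_inputsORev3 capMu_inputsORev3 capP_inputsORev3 capQ_inputsORev3 betaLE_corr_inputsORev3
    betaF3LE_corr_inputsORev3
  simpa only [Nat.cast_ofNat] using h

/-! ## §2  (S2b) on the window from the extended simplified form — the seven improvement-step rows PROVED -/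

/-- **The seven improvement-step diagram rows of the record at `p ∈ (p_I, p_c)`, PROVED** from the extended simplified form `NobleSimplifiedFormF3At 10 p BoRev3 EoL`
and `f₂(p) ≤ Γ₂ = GammaRev2 1`: `NobleWeightedDiagramBoundOf 𝒮₇ p boRev3` — witness (`exists_witness`) → `nobleH_le_boundHD75Phi_srwTrueAlt` (pointwise, no
(H-Γ)) → the seven kernel cells of `MeanFieldD10F3CellsRev2` (the seventh via `nobleH_single`: `ℋ^{1,17}_p(0) = ℋ^{1,16}_p(e₁)`).
[cite: FitznerVanDerHofstad2016NoBLE, §3.3.5 (3.58)–(3.87) pp. 1074–1079; (3.34)–(3.35) p. 1071] [cite: FitznerVanDerHofstad2017, Prop. 2.2 p. 11; (2.31)–(2.35) pp. 12–13] -/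
theorem nobleWeightedDiagramBoundOf_d10_Rev3_o {p : unitInterval} (hp : p ∈ Set.Ioo (nbwThresholdI 10) (criticalProbI 10))
    (hF3 : NobleSimplifiedFormF3At 10 p BoRev3 EoL) (hΓ2 : nobleF2 10 p ≤ GammaRev2 1) :
    NobleWeightedDiagramBoundOf famRev2 p boRev3 := by
  have hpc : (p : ℝ) < criticalProb (zdGraph 10) (0 : Site 10) := by
    rw [← coe_criticalProbI]
    exact Subtype.coe_lt_coe.2 hp.2
  have hW := hF3.exists_witness (by norm_num) hpc hΓ2 BoRev3_αFlow_pos BoRev3_gap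
  rw [toArgs_eq_aoQ] at hW
  have hle : ∀ {n : ℕ}, n ≤ 1 → ∀ (l : ℕ) (x : Site 10),
      nobleH 10 n l p x ≤ boundHD75Phi (srwTrueAlt 10 ((aoQ.afmin : ℚ) : ℝ) ((aoQ.afmax : ℚ) : ℝ)) n l x aoQ.toArgs :=
    fun hn l x => nobleH_le_boundHD75Phi_srwTrueAlt (d := 10) (by norm_num) hpc hW (ArgsQ.toArgs_WF aoQ_wf) one_le_afmin_toArgs hn l x
  have hz : (0 : ℕ) ≤ 1 := Nat.zero_le 1
  refine nobleWeightedDiagramBoundOf_of_forall boRev3_nonneg fun k => ?_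
  fin_cases k
  · show ∀ x ∈ calX 10, nobleH 10 0 0 p x ≤ boRev3 0
    exact fun x hx => ((hle hz 0 x).trans (cellX00 x hx)).trans (boQ_cast 0).le
  · show ∀ x ∈ calX 10, nobleH 10 1 0 p x ≤ boRev3 1
    exact fun x hx => ((hle le_rfl 0 x).trans (cellX10 x hx)).trans (boQ_cast 1).le
  · show ∀ x ∈ calX 10, nobleH 10 1 1 p x ≤ boRev3 2
    exact fun x hx => ((hle le_rfl 1 x).trans (cellX11 x hx)).trans (boQ_cast 2).le
  · show ∀ x ∈ calX 10, nobleH 10 1 2 p x ≤ boRev3 3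
    exact fun x hx => ((hle le_rfl 2 x).trans (cellX12 x hx)).trans (boQ_cast 3).le
  · show ∀ x ∈ calX 10, nobleH 10 1 3 p x ≤ boRev3 4
    exact fun x hx => ((hle le_rfl 3 x).trans (cellX13 x hx)).trans (boQ_cast 4).le
  · show ∀ x ∈ ({0} : Set (Site 10)), nobleH 10 1 6 p x ≤ boRev3 5
    intro x hx
    rw [Set.mem_singleton_iff] at hx
    subst hx
    exact ((hle le_rfl 6 0).trans cellO16).trans (boQ_cast 5).le
  · show ∀ x ∈ ({0} : Set (Site 10)), nobleH 10 1 17 p x ≤ boRev3 6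
    intro x hx
    rw [Set.mem_singleton_iff] at hx
    subst hx
    rw [← nobleH_single (d := 10) (by norm_num) 1 16 p hpc 0, ← Nd.pt_e1]
    exact ((hle le_rfl 16 (Nd.pt .e1)).trans cellE16).trans (boQ_cast 6).le

/-- **Binder `hS′` of the record with (S2b) REMOVED**: if, whenever the remainder table `R18` is kernel-valid, Assumption 4.3 holds at every `p ∈ (p_I, p_c)` with
`f^{𝒮₇}_j(p) ≤ Γ_j` with the constants `inputsORev3`, then `RemValid 10 18 R18 → NobleImprovementInputsOf 𝒮₇ cMuRev2 cWeightsRev2 GammaRev2 BoRev3 boRev3`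
— App. D by Level A (`β`-side) and §1 (`f₃`-side), the diagram rows by §2.
[cite: FitznerVanDerHofstad2016NoBLE, Prop. 4.5(ii) p. 1088; Assumption 4.3 pp. 1086–1087; (3.87) p. 1079] [cite: FitznerVanDerHofstad2017, Prop. 2.2 p. 11; §2.4 claim (iii) p. 13] -/
theorem nobleImprovementInputs_d10_Rev3_f3
    (hS43 : (RemValid 10 18 fun r => ((RemCertD10.R18 r : ℚ) : ℝ)) →
      ∀ (p : unitInterval) (hp : p ∈ Set.Ioo (nbwThresholdI 10) (criticalProbI 10)),
        (∀ j, nobleFOf (nobleTripleSnoc 10 ((1 : ℕ), (17 : ℕ), ({0} : Set (Site 10)))) cMuRev2 cWeightsRev2 j p ≤ GammaRev2 j) →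
          NobleAssumption43At 10 p (percolationNobleSplit 10 p (by norm_num) hp.2) inputsORev3) :
    (RemValid 10 18 fun r => ((RemCertD10.R18 r : ℚ) : ℝ)) →
      NobleImprovementInputsOf (nobleTripleSnoc 10 ((1 : ℕ), (17 : ℕ), ({0} : Set (Site 10)))) cMuRev2 cWeightsRev2 GammaRev2 BoRev3 boRev3 := by
  intro hR p hp hΓ
  have h43 := hS43 hR p hp hΓ
  have hp0 : 0 < (p : ℝ) :=
    lt_trans (nbwThresholdI_pos (by norm_num)) (show ((nbwThresholdI 10 : unitInterval) : ℝ) < p by exact_mod_cast hp.1)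
  have hF3 := nobleSimplifiedFormF3At_d10_Rev3_oL hp.2 hp0 h43
  have hΓ2 : nobleF2 10 p ≤ GammaRev2 1 := by simpa only [nobleFOf_one] using hΓ 1
  exact ⟨hF3.toSimplifiedFormAt, nobleWeightedDiagramBoundOf_d10_Rev3_o hp hF3 hΓ2⟩

/-! ## §3  (S2b) at `p_I = 1/19`, PROVED hypothesis-free, and the re-cut certificate -/

/-- **Binder `hI` of the record with (S2b) REMOVED and the re-cut table**: Assumption 4.3 at `p_I` with `inputsIRev3` gives `NobleInitialInputsOf 𝒮₇ BiRev3 biRev2L`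
— App. D by Level A (`betaLE_corr_inputsIRev3`), the diagram rows by `nobleWeightedDiagramBoundOf_d10_Rev2L_pI`.
[cite: FitznerVanDerHofstad2016NoBLE, Prop. 4.5(ii); Assumption 4.3, closing sentence p. 1088; §3.3.3 (3.31)] [cite: FitznerVanDerHofstad2017, Prop. 2.2 p. 11; §2.4 claims (i)–(ii) p. 13] -/
theorem nobleInitialInputs_d10_Rev3B_of_assumption43
    (hI43 : NobleAssumption43At 10 (nbwThresholdI 10)
      (percolationNobleSplit 10 (nbwThresholdI 10) (by norm_num) (nbwThresholdI_lt_criticalProbI (by norm_num))) inputsIRev3) :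
    NobleInitialInputsOf (nobleTripleSnoc 10 ((1 : ℕ), (17 : ℕ), ({0} : Set (Site 10)))) BiRev3 biRev2L :=
  nobleInitialInputsOf_mono betaLE_corr_inputsIRev3 (fun _ => le_rfl)
    (nobleInitialInputsOf_of_assumption43 (by norm_num) inputsIRev3_WF n1_inputsIRev3 n2_inputsIRev3 n3_inputsIRev3
      n4_inputsIRev3 hI43 nobleWeightedDiagramBoundOf_d10_Rev2L_pI)

/-! ## §4  The `d = 10` sentences at LEVEL B (conditional on Assumption 4.3 at the two input records ONLY) -/

/-- **`d = 10`, LEVEL B**: the triangle condition, `θ(p_c) = 0` and `β = 1` (bounded-ratio sense) on `ℤ¹⁰`, CONDITIONAL ON (S2a) ONLY — Assumption 4.3 of [NoBLE17]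
for percolation at `p_I` with `inputsIRev3` and, under `f^{𝒮₇} ≤ GammaRev2` on `(p_I, p_c)` and kernel-validity of `R18`, with `inputsORev3`.  Both (S2b)
diagram-row conjuncts of Level A are DISCHARGED in the kernel (§2, §3); the certificate is the re-cut `nobleCertificate_d10_Rev3`.
[cite: FitznerVanDerHofstad2016NoBLE, Thm. 2.10, Prop. 2.11, Def. 2.9 pp. 1060–1062; Prop. 4.5(ii) p. 1088] [cite: FitznerVanDerHofstad2017, Thm. 1.1, Cor. 1.3, Prop. 2.2] -/
theorem meanField_d10_Rev3_f3
    (hI43 : NobleAssumption43At 10 (nbwThresholdI 10)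
      (percolationNobleSplit 10 (nbwThresholdI 10) (by norm_num) (nbwThresholdI_lt_criticalProbI (by norm_num))) inputsIRev3)
    (hS43 : (RemValid 10 18 fun r => ((RemCertD10.R18 r : ℚ) : ℝ)) →
      ∀ (p : unitInterval) (hp : p ∈ Set.Ioo (nbwThresholdI 10) (criticalProbI 10)),
        (∀ j, nobleFOf (nobleTripleSnoc 10 ((1 : ℕ), (17 : ℕ), ({0} : Set (Site 10)))) cMuRev2 cWeightsRev2 j p ≤ GammaRev2 j) →
          NobleAssumption43At 10 p (percolationNobleSplit 10 p (by norm_num) hp.2) inputsORev3) :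
    TriangleCondition 10 ∧ PercolationContinuity 10 ∧ BetaEqOneBoundedRatio 10 :=
  meanField_of_certificateOf (by norm_num) nobleCertificate_d10_Rev3 (nobleInitialInputs_d10_Rev3B_of_assumption43 hI43)
    (nobleImprovementInputs_d10_Rev3_f3 hS43 RemCertD10.remValid_d10_cs18)

/-- **`d = 10`, LEVEL B: `MeanField 10`** under the same two (S2a) binders. [cite: FitznerVanDerHofstad2017, Thm. 1.1 and Cor. 1.3 (shape of the conclusion)] -/
theorem meanField_full_d10_Rev3_f3
    (hI43 : NobleAssumption43At 10 (nbwThresholdI 10)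
      (percolationNobleSplit 10 (nbwThresholdI 10) (by norm_num) (nbwThresholdI_lt_criticalProbI (by norm_num))) inputsIRev3)
    (hS43 : (RemValid 10 18 fun r => ((RemCertD10.R18 r : ℚ) : ℝ)) →
      ∀ (p : unitInterval) (hp : p ∈ Set.Ioo (nbwThresholdI 10) (criticalProbI 10)),
        (∀ j, nobleFOf (nobleTripleSnoc 10 ((1 : ℕ), (17 : ℕ), ({0} : Set (Site 10)))) cMuRev2 cWeightsRev2 j p ≤ GammaRev2 j) →
          NobleAssumption43At 10 p (percolationNobleSplit 10 p (by norm_num) hp.2) inputsORev3) :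
    MeanField 10 :=
  meanField_of_triangle (by norm_num) (meanField_d10_Rev3_f3 hI43 hS43).1

/-- **`d = 10`, LEVEL B: the NoBLE infrared bound `NobleBootstrapBound 10`** under the same two (S2a) binders. [cite: FitznerVanDerHofstad2016NoBLE, Thm. 2.10 (2.17) p. 1060] -/
theorem nobleBootstrapBound_d10_Rev3_f3
    (hI43 : NobleAssumption43At 10 (nbwThresholdI 10)
      (percolationNobleSplit 10 (nbwThresholdI 10) (by norm_num) (nbwThresholdI_lt_criticalProbI (by norm_num))) inputsIRev3)
    (hS43 : (RemValid 10 18 fun r => ((RemCertD10.R18 r : ℚ) : ℝ)) →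
      ∀ (p : unitInterval) (hp : p ∈ Set.Ioo (nbwThresholdI 10) (criticalProbI 10)),
        (∀ j, nobleFOf (nobleTripleSnoc 10 ((1 : ℕ), (17 : ℕ), ({0} : Set (Site 10)))) cMuRev2 cWeightsRev2 j p ≤ GammaRev2 j) →
          NobleAssumption43At 10 p (percolationNobleSplit 10 p (by norm_num) hp.2) inputsORev3) :
    NobleBootstrapBound 10 :=
  nobleBootstrapBound_of_certificateOf (by norm_num) nobleCertificate_d10_Rev3 (nobleInitialInputs_d10_Rev3B_of_assumption43 hI43)
    (nobleImprovementInputs_d10_Rev3_f3 hS43 RemCertD10.remValid_d10_cs18)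

/-- The ladder step at LEVEL B: with (S2a) at the two input records, «∀ d ≥ 11, TriangleCondition d» upgrades to «∀ d ≥ 10, TriangleCondition d».
[cite: FitznerVanDerHofstad2017, Thm. 1.1 and Cor. 1.3 pp. 5–6 (shape of the conclusion)] -/
theorem triangleConditionFrom_d10_Rev3_f3
    (hI43 : NobleAssumption43At 10 (nbwThresholdI 10)
      (percolationNobleSplit 10 (nbwThresholdI 10) (by norm_num) (nbwThresholdI_lt_criticalProbI (by norm_num))) inputsIRev3)
    (hS43 : (RemValid 10 18 fun r => ((RemCertD10.R18 r : ℚ) : ℝ)) →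
      ∀ (p : unitInterval) (hp : p ∈ Set.Ioo (nbwThresholdI 10) (criticalProbI 10)),
        (∀ j, nobleFOf (nobleTripleSnoc 10 ((1 : ℕ), (17 : ℕ), ({0} : Set (Site 10)))) cMuRev2 cWeightsRev2 j p ≤ GammaRev2 j) →
          NobleAssumption43At 10 p (percolationNobleSplit 10 p (by norm_num) hp.2) inputsORev3)
    (h11 : Summit.CriticalPhenomena.LaceExpansionHighD.TriangleConditionFrom 11) :
    Summit.CriticalPhenomena.LaceExpansionHighD.TriangleConditionFrom 10 :=
  Summit.CriticalPhenomena.LaceExpansionHighD.triangleConditionFrom_of_rung (meanField_d10_Rev3_f3 hI43 hS43).1 h11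

end Rev3

end D10

end Summit.CriticalPhenomena.LaceExpansionHighD

end
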